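import Mathlib
import HarnessLib
import Summits.ResolutionOfSingularities.ResolutionOfSingularities.Theorems.WildQuotientsWildQuotientResolutionS1aOrbitRule
import Summits.ResolutionOfSingularities.ResolutionOfSingularities.Theorems.WildQuotientsWildQuotientResolutionS1aWinsOfTouchRule

/-!
# S1a — `WinsOfOrbitRule p` PROVED: the registered stub ⇐ `KillTouchReach p ∧ AuxWithinReach p` (lead-1 g9 reshape of BOTH research stubs)

[OURS · L1 W4.5c · lead-1 g9; the `Theses`-cone wrapper of `…S1aOrbitRule`] — NOT statements of the manuscript; counted 0; AI-level work, weaker than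
expert review. Crux stmt-ResolutionOfSingularities-17941, line `s1a-logminvertex` v9, registered stub `stub_winningStrategy`.

* ★★ `winningStrategy_of_killTouchReach_of_auxWithinReach : p.Prime → KillTouchReach p → AuxWithinReach p → FrameWins.WinningStrategy p` —
  `wins_of_touchOrTopOrOrbitSeq` with `P := Reachable (initial)` (measure: `jInf`, then `topCount`, then per branch `nIrrComp badLocus` / sequence length);
* `WinsOfOrbitRule p`, `winsOfOrbitRule : WinsOfOrbitRule p`; `winsOfTouchRule_of_winsOfOrbitRule` (the v8 residual follows, `AuxTopWithinReach ⇒ AuxWithinReach`);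
* `cyclicQuotientFourfolds_of_door_of_killTouchReach_of_auxWithinReach` (door + the two research statements ⇒ the sub-crux).
-/

set_option linter.dupNamespace false

noncomputable section

open CategoryTheory Limits AlgebraicGeometry TopologicalSpace
open Literature.AlgebraicGeometry.Resolution Literature.AlgebraicGeometry.RelativeSpec
open Summit.ResolutionOfSingularities.ResolutionOfSingularities.Theorems.WildQuotientResolution.S1
open Summit.ResolutionOfSingularities.ResolutionOfSingularities.Theorems.WildQuotientResolution.S1.NodeAtlas
open Summit.ResolutionOfSingularities.ResolutionOfSingularities.Theorems.WildQuotientResolution.S1.GameFrame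

namespace Summit.ResolutionOfSingularities.ResolutionOfSingularities.Theorems.WildQuotientResolution.S1

/-- ★★ **THE TERMINATION CRUX FROM THE TOUCH + (TOP ∨ ORBIT) FORMS**: `KillTouchReach p ∧ AuxWithinReach p ⇒ WinningStrategy p` (`p` prime), by the
nested induction `wins_of_touchOrTopOrOrbitSeq` with the invariant class `P := Reachable (initial)`. [OURS · L1 W4.5c] -/
theorem winningStrategy_of_killTouchReach_of_auxWithinReach {p : ℕ} (hp : p.Prime) (hK : KillTouchReach p) (hA : AuxWithinReach p) :
    FrameWins.WinningStrategy p := by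
  intro k _ _ _ X' X₁ f q G _ _ ρ hG hfs hfft hfqc hX₁ _ hreg hqfin hqs hqet hq horb hdim hinj g₀ hg₀ _ h₀
  haveI := hfft
  haveI := hfqc
  haveI := hqfin
  have HK := hK k X' X₁ f q G ρ hG hfs hfft hfqc hX₁ hreg hqfin hqs hqet hq horb hdim hinj g₀ hg₀ h₀
  have HA := hA k X' X₁ f q G ρ hG hfs hfft hfqc hX₁ hreg hqfin hqs hqet hq horb hdim hinj g₀ hg₀ h₀
  refine GameFrame.GModel.wins_of_touchOrTopOrOrbitSeq hp hg₀ ((GameFrame.GModel.initial hq h₀).Reachable)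
    (fun M M' 𝒦 d hR hadm hmv => GameFrame.GModel.Reachable.move 𝒦 d hR hadm hmv)
    (fun M _ => GameFrame.GModel.hasNoetherianBase_of_datum f M) (fun M _ => GameFrame.GModel.exists_nat_nu1_lt_of_datum f M)
    (fun M _ => GameFrame.GModel.compactSpace_of_datum f M)
    (fun M hR hT => ?_) (GameFrame.GModel.initial hq h₀) GameFrame.GModel.Reachable.refl
  by_cases hj : M.jInf = ⊥
  · exact Or.inl ⟨hj, HK M hR hT hj⟩
  · rcases HA M hR hT hj with ⟨n, hn⟩ | ⟨n, hn⟩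
    · exact Or.inr (Or.inl ⟨n, GameFrame.GModel.auxAltWithin_of_auxTopWithin hp hg₀
        (fun M => GameFrame.GModel.hasNoetherianBase_of_datum f M) n M hn⟩)
    · exact Or.inr (Or.inr ⟨n, hn⟩)

/-- **`WinsOfOrbitRule p`**: the game side of the residual after the lead-1 g9 reshape of both research stubs. [OURS · L1 W4.5c] -/
def WinsOfOrbitRule (p : ℕ) : Prop :=
  p.Prime → KillTouchReach p → AuxWithinReach p → FrameWins.WinningStrategy p

/-- ★★ **`WinsOfOrbitRule p` HOLDS** for every `p`. [OURS · L1 W4.5c] -/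
theorem winsOfOrbitRule (p : ℕ) : WinsOfOrbitRule p :=
  fun hp hK hA => winningStrategy_of_killTouchReach_of_auxWithinReach hp hK hA

/-- Nothing is lost: the v8 residual `WinsOfTouchRule p` follows (`AuxTopWithinReach ⇒ AuxWithinReach`). [OURS · L1 W4.5c] -/
theorem winsOfTouchRule_of_winsOfOrbitRule {p : ℕ} (h : WinsOfOrbitRule p) : WinsOfTouchRule p :=
  fun hp hK hA => h hp hK (auxWithinReach_of_auxTopWithinReach hA)

/-- **Door + the two research statements (touch + top-or-orbit forms) ⇒ the sub-crux `CyclicQuotientFourfolds`.** [OURS · L1 W4.5c] -/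
theorem cyclicQuotientFourfolds_of_door_of_killTouchReach_of_auxWithinReach (hD : FrameWins.DoorStatement)
    (hK : ∀ p : ℕ, p.Prime → KillTouchReach p) (hA : ∀ p : ℕ, p.Prime → AuxWithinReach p) :
    Summit.ResolutionOfSingularities.ResolutionOfSingularities.Theses.WildQuotients.CyclicQuotientFourfolds :=
  FrameWins.cyclicQuotientFourfolds_of_door_of_wins hD fun p hp _ =>
    winningStrategy_of_killTouchReach_of_auxWithinReach hp (hK p hp) (hA p hp)

end Summit.ResolutionOfSingularities.ResolutionOfSingularities.Theorems.WildQuotientResolution.S1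

end
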